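import Literature.NumberTheory.GaloisCohomology.KatoCohomologyDifferentialForms
import Mathlib.LinearAlgebra.ExteriorPower.Basic
import Mathlib.RingTheory.Kaehler.Basic
import Mathlib.RingTheory.Derivation.Basic
import HarnessLib

/-!
# Stub `stub_bkForward` of crux stmt-ResolutionOfSingularities-17142
# (`WildPurity.PurityTransfer`, line `birth`, lead c1 skeleton rev L4)

The FORWARD comparison map of the Bloch–Kato presentation (Bloch–Kato 1986, Lemma (4.2)): for a
field `K` of characteristic `p` and `n ≥ 0` there is an additive map
`δ : KatoCohomologySymbolic p K n →+ KatoCohomologyDeRham p K n` with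
`δ [a, b₀, …, b_{n-1}} = class of a · dlog b₀ ∧ ⋯ ∧ dlog b_{n-1}` (`formClass p a b`).

It is `KatoCohomologySymbolic.lift` applied to `formClass p`, which respects Kato's relations:
(1), (2), (3), (5) are the tree lemmas `formClass_add`, `formClass_update_mul`,
`formClass_eq_zero_of_apply_eq`, `formClass_artinSchreier`; relation (4), `δ [bᵢ, b} = 0`, is the
EXACTNESS of the form `bᵢ · dlog b₀ ∧ ⋯ ∧ dlog b_{n-1}` (`bkForward_smul_dlogForm_mem_exactForms`):
after swapping slot `i` to the front (`AlternatingMap.map_swap`),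
`b₀ · dlog b₀ ∧ dlog y₁ ∧ ⋯ = d (b₀ · dlog y₁ ∧ ⋯)` (`bkForward_d_smul_dlogForm`), because
`d (dlog y₁ ∧ ⋯ ∧ dlog yₘ) = 0` (`bkForward_d_dlogForm`, from `d (dlog u) = d(u⁻¹) ∧ du =
-u⁻² • (du ∧ du) = 0` and the graded Leibniz rule in the exterior algebra of `Ω[K⁄ℤ]`).
-/

set_option linter.dupNamespace false

noncomputable section

universe u

open Literature.NumberTheory.GaloisCohomology
open KaehlerDifferential (D)
open ExteriorAlgebra (ι)
open Literature.AlgebraicGeometry.Crystalline (ιMul coe_ιMul)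
open Literature.AlgebraicGeometry.Crystalline.KaehlerExteriorDerivative

namespace Summit.ResolutionOfSingularities.ResolutionOfSingularities.Theorems.WildPurityPurityTransfer

/-- `d (dlog u) = 0` in the algebra of differential forms `⋀_K Ω[K⁄ℤ]`, for a unit `u`:
`d (u⁻¹ • du) = d(u⁻¹) ∧ du = -u⁻² • (du ∧ du) = 0`. [folklore] -/
theorem bkForward_extD_ι_unitDlog (K : Type u) [CommRing K] (u : Kˣ) :
    extD ℤ K (ι K (unitDlog K u)) = 0 := by
  unfold unitDlog
  rw [extD_ι_smul_D, (D ℤ K).leibniz_of_mul_eq_one (Units.inv_mul u), map_smul,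
    smul_mul_assoc, ExteriorAlgebra.ι_sq_zero, smul_zero]

/-- `d (dlog v₀ ∧ ⋯ ∧ dlog v_{m-1}) = 0` in the algebra of differential forms `⋀_K Ω[K⁄ℤ]`
(graded Leibniz rule and `d (dlog u) = 0`). [folklore] -/
theorem bkForward_extD_ιMulti_unitDlog (K : Type u) [CommRing K] (m : ℕ) (v : Fin m → Kˣ) :
    extD ℤ K (ExteriorAlgebra.ιMulti K m fun i => unitDlog K (v i)) = 0 := by
  induction m with
  | zero =>
    rw [ExteriorAlgebra.ιMulti_zero_apply, ← (algebraMap K (ExteriorAlgebra K (Ω[K⁄ℤ]))).map_one,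
      extD_algebraMap, Derivation.map_one_eq_zero, map_zero]
  | succ m ih =>
    rw [ExteriorAlgebra.ιMulti_succ_apply, extD_mul, CliffordAlgebra.involute_ι, neg_mul,
      bkForward_extD_ι_unitDlog, zero_mul, zero_add]
    change -(ι K (unitDlog K (v 0)) *
      extD ℤ K (ExteriorAlgebra.ιMulti K m fun i => unitDlog K (Matrix.vecTail v i))) = 0
    rw [ih, mul_zero, neg_zero]

/-- `d (dlog y₀ ∧ ⋯ ∧ dlog y_{m-1}) = 0` for the exterior derivative on `m`-forms
`d : Ωᵐ_K → Ωᵐ⁺¹_K`. [folklore] -/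
theorem bkForward_d_dlogForm (K : Type u) [CommRing K] (m : ℕ) (y : Fin m → Kˣ) :
    kaehlerExteriorDerivative ℤ K m (dlogForm K y) = 0 :=
  Subtype.ext (by
    rw [coe_kaehlerExteriorDerivative, dlogForm, exteriorPower.ιMulti_apply_coe,
      bkForward_extD_ιMulti_unitDlog, Submodule.coe_zero])

/-- **`d (b₀ · dlog y₀ ∧ ⋯ ∧ dlog y_{m-1}) = b₀ · dlog b₀ ∧ dlog y₀ ∧ ⋯ ∧ dlog y_{m-1}`**
(`= db₀ ∧ dlog y₀ ∧ ⋯`): the computation behind relation (4) of the Bloch–Kato presentation.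
[cite: BlochKato1986, Lemma (4.2)] -/
theorem bkForward_d_smul_dlogForm (K : Type u) [CommRing K] (m : ℕ) (b₀ : Kˣ) (y : Fin m → Kˣ) :
    kaehlerExteriorDerivative ℤ K m ((b₀ : K) • dlogForm K y) =
      (b₀ : K) • dlogForm K (Fin.cons b₀ y : Fin (m + 1) → Kˣ) := by
  rw [kaehlerExteriorDerivative_smul, bkForward_d_dlogForm, smul_zero, add_zero]
  apply Subtype.ext
  rw [coe_ιMul, Submodule.coe_smul, dlogForm, dlogForm, exteriorPower.ιMulti_apply_coe,
    exteriorPower.ιMulti_apply_coe, ExteriorAlgebra.ιMulti_succ_apply]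
  change ι K (D ℤ K (b₀ : K)) * ExteriorAlgebra.ιMulti K m (fun i => unitDlog K (y i)) =
    (b₀ : K) • (ι K (unitDlog K ((Fin.cons b₀ y : Fin (m + 1) → Kˣ) 0)) *
      ExteriorAlgebra.ιMulti K m fun i => unitDlog K ((Fin.cons b₀ y : Fin (m + 1) → Kˣ) i.succ))
  simp only [Fin.cons_zero, Fin.cons_succ]
  rw [unitDlog, map_smul, smul_mul_assoc, smul_smul, Units.mul_inv, one_smul]

/-- Relation (4) on forms, slot `0`: `b₀ · dlog b₀ ∧ ⋯ ∧ dlog bₘ ∈ Bᵐ⁺¹_K = dΩᵐ_K`.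
[cite: BlochKato1986, Lemma (4.2)] -/
theorem bkForward_smul_dlogForm_mem_exactForms_zero (K : Type u) [CommRing K] (m : ℕ)
    (b : Fin (m + 1) → Kˣ) : ((b 0 : Kˣ) : K) • dlogForm K b ∈ exactForms K (m + 1) := by
  rw [mem_exactForms_succ_iff]
  refine ⟨((b 0 : Kˣ) : K) • dlogForm K (Fin.tail b), ?_⟩
  rw [bkForward_d_smul_dlogForm, Fin.cons_self_tail]

/-- **Relation (4) on forms**: `bᵢ · dlog b₀ ∧ ⋯ ∧ dlog b_{n-1} ∈ Bⁿ_K = dΩⁿ⁻¹_K` is exact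
(reduce to `i = 0` by the alternating property). [cite: BlochKato1986, Lemma (4.2)] -/
theorem bkForward_smul_dlogForm_mem_exactForms (K : Type u) [CommRing K] {n : ℕ}
    (b : Fin n → Kˣ) (i : Fin n) : ((b i : Kˣ) : K) • dlogForm K b ∈ exactForms K n := by
  cases n with
  | zero => exact i.elim0
  | succ m =>
    by_cases hi : i = 0
    · subst hi
      exact bkForward_smul_dlogForm_mem_exactForms_zero K m b
    · have hswap : dlogForm K (b ∘ Equiv.swap 0 i) = -dlogForm K b :=
        (exteriorPower.ιMulti K (m + 1)).map_swap (fun j => unitDlog K (b j)) (Ne.symm hi)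
      have h0 : (b ∘ Equiv.swap 0 i) 0 = b i := by
        simp only [Function.comp_apply, Equiv.swap_apply_left]
      have h := bkForward_smul_dlogForm_mem_exactForms_zero K m (b ∘ Equiv.swap 0 i)
      rw [h0, hswap, smul_neg] at h
      exact neg_mem_iff.mp h

/-- **Stub `stub_bkForward`** — the forward comparison map of the Bloch–Kato presentation: for a
field `K` of characteristic `p` there is an additive map
`δ : KatoCohomologySymbolic p K n →+ KatoCohomologyDeRham p K n = Ωⁿ_K ⧸ (Bⁿ_K ⊔ AS)` with
`δ [a, b} = class of a · dlog b₀ ∧ ⋯ ∧ dlog b_{n-1}`. It is `KatoCohomologySymbolic.lift` of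
`formClass p`; relations (1), (2), (3), (5) hold on forms by `formClass_add`, `formClass_update_mul`,
`formClass_eq_zero_of_apply_eq`, `formClass_artinSchreier`, and relation (4) `[bᵢ, b} ↦ 0` because
`bᵢ · dlog b₀ ∧ ⋯ ∧ dlog b_{n-1}` is exact (`bkForward_smul_dlogForm_mem_exactForms`).
[cite: BlochKato1986, Lemma (4.2)] -/
theorem stub_bkForward (p : ℕ) [Fact p.Prime] (K : Type u) [Field K] [CharP K p] (n : ℕ) :
    ∃ φ : KatoCohomologySymbolic p K n →+ KatoCohomologyDeRham p K n,
      ∀ (a : K) (b : Fin n → Kˣ), φ (KatoCohomologySymbolic.symbol p a b) = formClass p a b :=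
  ⟨KatoCohomologySymbolic.lift p (formClass p)
    { add_left := formClass_add p
      update_mul := formClass_update_mul p
      eq_zero_of_apply_eq := fun a b _ _ hij h => formClass_eq_zero_of_apply_eq p a b hij h
      apply_self := fun b i => (QuotientAddGroup.eq_zero_iff _).2
        (AddSubgroup.mem_sup_left (bkForward_smul_dlogForm_mem_exactForms K b i))
      artinSchreier := formClass_artinSchreier p },
    fun a b => KatoCohomologySymbolic.lift_symbol p _ _ a b⟩

end Summit.ResolutionOfSingularities.ResolutionOfSingularities.Theorems.WildPurityPurityTransfer

end
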